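import Mathlib
import Summits.KontsevichZagierPeriods.Zeta5Search.BrickTopKummer
import Summits.KontsevichZagierPeriods.Zeta5Search.BrickTopOffDigit

/-!
# BrickOffDigitSide — THEOREM 6 Step G⁺: every OFF-DIGIT term has `v_p(p^{2τ_s}·c_{K,s}(np)) ≥ A − 2`
(`K = jp + i`, `p ∤ K`, `n < p²`; cell zeta5-irr)

HONEST FRAMING: systematic search; no irrationality claim unless certified. INSTRUMENT lemma of the ζ(5)
census cell zeta5-irr (HOME `run/shared/lean/pub/zeta5-irr/`; memo `zi-p2/probes/B8/thm6/THEOREM6.md` Step G⁺ /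
THEOREM5.md Step G: the off-digit half `OFF^{(s)} := Σ_{K ≤ np, p∤K} p^{2τ_s}c_{K,s}(np)` of
`β_s(np) − β_s(n)`; PLAN-T7 L7.8 is the level-2 analogue). Nothing here is about ζ(5); no irrationality content;
filing moves no rung. Filed by the engine seat zi-eng (g8): assembly of `BrickTopOffDigit.padicValRat_cTop_offDigit`
(zi-eng g7: the exact off-digit top valuation `A(1 + v((n−j)C(n,j))) + B(v(C(n+j,j)) + v(C(2n−1−j,n)))`),
`BrickCellValuation.cell_valuation` at level `L = 2` for the kernel `R_{np}` (`np < p³`) and Kummer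
(`BrickTopKummer.one_le_padicValNat_choose_add`): the two `p³`-distant roots of `F_K` for `R_{np}` are paid for by the
digit-1 carries of `n + j` and `(n−1−j) + n`.

## The statement

`p` odd prime, `2B ≤ A`, `n < p²`, `j < n`, `1 ≤ i < p`, `K = jp + i`, `s + 1 ≤ A`, `τ_s = A − 1 − s`:

**`v(p^{2τ_s}·cell A B 1 (np) K s) ≤ exp(2 − A)`**, i.e. `v_p(p^{2τ_s}c_{K,s}(np)) ≥ A − 2` (`offDigit_term_le`);
hence for `A ≥ 5` every off-digit term is `≡ 0 (mod p³)`, and so is their sum over `{K ≤ np : p ∤ K}` (summed in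
`BrickTheoremSixS.theoremSix_S`; there is no separate `offDigit_sum_le` declaration — precision note zi-ref t6s-1).
-/

namespace Summit.KontsevichZagierPeriods.Zeta5Search.BrickOffDigitSide

open Finset Nat WithZero
open Summit.KontsevichZagierPeriods.Zeta5Search.BrickTopCoefficient (cTop)
open Summit.KontsevichZagierPeriods.Zeta5Search.BrickLaurent (cell)
open Summit.KontsevichZagierPeriods.Zeta5Search.BrickCellValuation (sigmaTop cell_valuation)
open Summit.KontsevichZagierPeriods.Zeta5Search.BrickTopKummer (one_le_padicValNat_choose_add)
open Summit.KontsevichZagierPeriods.Zeta5Search.BrickTopOffDigit (padicValRat_cTop_offDigit not_dvd_centre)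

noncomputable section

variable {p : ℕ} [Fact p.Prime]

/-- The `p³`-distant roots of `F_K` for `R_{np}` (`K = jp + i` off-digit) occur only with a digit-1 carry:
`σ^{(2)}_K(np) ≤ [p² ≤ n + j] + [p² ≤ 2n − 1 − j]`. -/
theorem sigmaTop_offDigit_le {n j i : ℕ} (hjn : j < n) (hi1 : 1 ≤ i) (hip : i < p) :
    sigmaTop p 2 (n * p) (j * p + i) ≤ (if p ^ 2 ≤ n + j then 1 else 0) + (if p ^ 2 ≤ 2 * n - 1 - j then 1 else 0) := by
  have hp : p.Prime := Fact.out
  have hp3 : p ^ (2 + 1) = p ^ 2 * p := pow_succ p 2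
  unfold sigmaTop
  refine Nat.add_le_add ?_ ?_
  · split_ifs with h1 h2
    · exact le_rfl
    · exfalso
      have h3 : (n + j + 1) * p ≤ p ^ 2 * p := Nat.mul_le_mul_right _ (by omega)
      have h4 : (n + j + 1) * p = n * p + j * p + p := by ring
      omega
    · exact Nat.zero_le _
    · exact le_rfl
  · split_ifs with h1 h2
    · exact le_rfl
    · exfalso
      obtain ⟨k, hk⟩ : ∃ k, 2 * n = k + j := ⟨2 * n - j, by omega⟩
      have h3 : k * p ≤ p ^ 2 * p := Nat.mul_le_mul_right _ (by omega)
      have h4 : 2 * (n * p) = k * p + j * p := by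
        calc 2 * (n * p) = (2 * n) * p := by ring
          _ = (k + j) * p := by rw [hk]
          _ = k * p + j * p := by ring
      have hkp : 0 < k * p := Nat.mul_pos (by omega) hp.pos
      rw [hp3, h4] at h1
      omega
    · exact Nat.zero_le _
    · exact le_rfl

/-- The off-digit top coefficient pays `A` plus the two carries:
`v(cTop A B ε (np) (jp+i)) ≤ exp(−(A + B([p² ≤ n+j] + [p² ≤ 2n−1−j])))`. -/
theorem padicValuation_cTop_offDigit_le (hp2 : p ≠ 2) (A B ε : ℕ) {n j i : ℕ} (hn : n < p ^ 2) (hjn : j < n)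
    (hi1 : 1 ≤ i) (hip : i < p) :
    Rat.padicValuation p (cTop A B ε (n * p) (j * p + i)) ≤
      exp (-((A + B * ((if p ^ 2 ≤ n + j then 1 else 0) + (if p ^ 2 ≤ 2 * n - 1 - j then 1 else 0)) : ℕ) : ℤ)) := by
  have hp : p.Prime := Fact.out
  have hval := padicValRat_cTop_offDigit (p := p) hp2 A B ε hjn hi1 hip
  -- `cTop ≠ 0`
  have hne : cTop A B ε (n * p) (j * p + i) ≠ 0 := by
    unfold cTop
    have hK : j * p + i ≤ n * p := by nlinarith
    refine mul_ne_zero (mul_ne_zero (mul_ne_zero (pow_ne_zero _ (by norm_num)) (pow_ne_zero _ ?_))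
      (pow_ne_zero _ ?_)) (pow_ne_zero _ (mul_ne_zero ?_ ?_))
    · rw [show ((n * p : ℕ) : ℚ) / 2 - ((j * p + i : ℕ) : ℚ) = (((n * p : ℤ) - 2 * (j * p + i) : ℤ) : ℚ) / 2 by
        push_cast; ring]
      refine div_ne_zero (Int.cast_ne_zero.2 fun h => not_dvd_centre hp hp2 n j hi1 hip ?_) two_ne_zero
      rw [h]; exact dvd_zero _
    · exact_mod_cast (Nat.choose_pos hK).ne'
    · exact_mod_cast (Nat.choose_pos (Nat.le_add_left _ _)).ne'
    · exact_mod_cast (Nat.choose_pos (by omega : n * p ≤ 2 * (n * p) - (j * p + i))).ne'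
  have e : Rat.padicValuation p (cTop A B ε (n * p) (j * p + i)) = exp (-padicValRat p (cTop A B ε (n * p) (j * p + i))) :=
    if_neg hne
  rw [e, hval, exp_le_exp, neg_le_neg_iff]
  have hn' : n < p ^ (1 + 1) := by simpa using hn
  have ha : p ^ 2 ≤ n + j → (1 : ℤ) ≤ padicValNat p ((n + j).choose j) := fun h => by
    exact_mod_cast one_le_padicValNat_choose_add (L := 1) hn' (by omega) (by simpa using h)
  have hb : p ^ 2 ≤ 2 * n - 1 - j → (1 : ℤ) ≤ padicValNat p ((2 * n - 1 - j).choose n) := fun h => by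
    have h' := one_le_padicValNat_choose_add (p := p) (L := 1) (n := n - 1 - j) (k := n) (by omega) hn'
      (by rw [show n - 1 - j + n = 2 * n - 1 - j by omega]; simpa using h)
    rw [show n - 1 - j + n = 2 * n - 1 - j by omega] at h'
    exact_mod_cast h'
  have h0 : (0 : ℤ) ≤ padicValNat p ((n - j) * n.choose j) := Int.natCast_nonneg _
  have h1 : (0 : ℤ) ≤ padicValNat p ((n + j).choose j) := Int.natCast_nonneg _
  have h2 : (0 : ℤ) ≤ padicValNat p ((2 * n - 1 - j).choose n) := Int.natCast_nonneg _
  have hA0 : (0 : ℤ) ≤ A := Int.natCast_nonneg _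
  have hB0 : (0 : ℤ) ≤ B := Int.natCast_nonneg _
  simp only [Nat.cast_add, Nat.cast_mul, Nat.cast_ite, Nat.cast_one, Nat.cast_zero]
  split_ifs with c1 c2 c2
  · have := ha c1; have := hb c2; nlinarith
  · have := ha c1; nlinarith
  · have := hb c2; nlinarith
  · nlinarith

/-- **STEP G⁺, termwise**: `v_p(p^{2τ_s}·c_{K,s}(np)) ≥ A − 2` for every off-digit `K = jp + i` (`j < n < p²`,
`1 ≤ i < p`, `2B ≤ A`, `s + 1 ≤ A`, odd `p`). -/
theorem offDigit_term_le (hp2 : p ≠ 2) {A B n j i s : ℕ} (hAB : 2 * B ≤ A) (hn : n < p ^ 2) (hjn : j < n)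
    (hi1 : 1 ≤ i) (hip : i < p) (hs : s + 1 ≤ A) :
    Rat.padicValuation p ((p : ℚ) ^ (2 * (A - 1 - s)) * cell A B 1 (n * p) (j * p + i) s) ≤ exp (2 - (A : ℤ)) := by
  have hp : p.Prime := Fact.out
  have hK : j * p + i ≤ n * p := by nlinarith
  have hc : 2 * (j * p + i) ≠ n * p := fun h => not_dvd_centre hp hp2 n j hi1 hip (by
    have h' : ((2 * (j * p + i) : ℕ) : ℤ) = ((n * p : ℕ) : ℤ) := by exact_mod_cast h
    push_cast at h'
    rw [show ((n * p : ℤ)) - 2 * (j * p + i) = 0 by linarith]; exact dvd_zero _)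
  have hnp : n * p < p ^ (2 + 1) := by rw [pow_succ]; exact Nat.mul_lt_mul_of_pos_right hn hp.pos
  have hcell := cell_valuation (p := p) hAB (L := 2) (ε := 1) hnp hK (Or.inl hc) s
  have htop := padicValuation_cTop_offDigit_le (p := p) hp2 A B 1 hn hjn hi1 hip
  have hσ := sigmaTop_offDigit_le (p := p) hjn hi1 hip
  rw [map_mul, map_pow, Rat.padicValuation_self, ← exp_nsmul]
  refine (mul_le_mul' le_rfl (hcell.trans (mul_le_mul' htop le_rfl))).trans ?_
  rw [← exp_add, ← exp_add, exp_le_exp, nsmul_eq_mul]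
  have hBσ : (B : ℤ) * ((sigmaTop p 2 (n * p) (j * p + i) : ℕ) : ℤ) ≤
      (B : ℤ) * (((if p ^ 2 ≤ n + j then 1 else 0) + (if p ^ 2 ≤ 2 * n - 1 - j then 1 else 0) : ℕ) : ℤ) :=
    mul_le_mul_of_nonneg_left (by exact_mod_cast hσ) (Int.natCast_nonneg B)
  push_cast [show s ≤ A - 1 by omega, show 1 ≤ A by omega, show s ≤ A by omega]
  push_cast at hBσ
  linarith

end

end Summit.KontsevichZagierPeriods.Zeta5Search.BrickOffDigitSide
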